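import Mathlib
import HarnessLib

/-!
# S2β · `hFlat` road, brick (G8) of UV3-NODE §64.2 — THE SCHUR TEST for a nonnegative kernel on finite index sets:
# row sums `≤ R`, column sums `≤ C` ⟹ `Σ_a (Σ_b K a b·g b)² ≤ R·C·Σ_b (g b)²`, i.e. `‖T‖_{ℓ²→ℓ²} ≤ √(R·C)`

Cell `ym3-torus` (rung R3 = continuum `SU(2)` Yang–Mills on the three-torus — NOT d = 4, NOT infinite volume, NOT a mass gap, NOT Clay).
Width seat «width 8» `ym3-torus-px8` (gen 21), FREE px helper on crux `stmt-QuantumFields-20520`, count-neutral, DEFINITION-FREE, Mathlib-only.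

WHY (UV3-NODE §64.2).  The one-level tent kernel `T_t` of the KEY LEMMA (coarse plaquette `P = (y, μν)` ↦ `(L³)⁻¹Σ_{x∈B(y)}Σ_{P′∈□_L(x)}`) has row sums `L²` and column
sums `L⁻¹` EXACTLY, so this file gives `‖T_t‖ ≤ √L` with constant ONE; operator norms multiply along the tower (`‖T_t⋯T_{i+1}‖ ≤ L^{(t−i)∕2}`), which is why no
nested-tent combinatorics is needed (✓`…TentCoverage` is the one-shot count at side `N`).
* `sq_sum_mul_le_sum_mul_sum_mul_sq` — one row: `(Σ_b K_b·g_b)² ≤ (Σ_b K_b)·(Σ_b K_b·g_b²)` for `K ≥ 0` (Cauchy–Schwarz with weights `√K`).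
* ★★ `schur_test_sq` — `Σ_{a∈s}(Σ_{b∈t} K a b·g b)² ≤ R·C·Σ_{b∈t}(g b)²`; `schur_test` — the square-rooted form `√(Σ_a (Σ_b K·g)²) ≤ √(R·C)·√(Σ_b g²)`.

HONEST SCOPE.  Finite sums (Mathlib `Finset.sum_mul_sq_le_sq_mul_sq`, `Finset.sum_comm`); nothing of Bałaban's analysis; the docking (the counts `L²`, `L⁻¹` on the
`Setup` torus), the KEY LEMMA, the recursion, `hFlat`, TUBE-REG∘, GAP♯∘, S2β, crux 20520 and `YM3TorusSU2` are NOT proved; no registered stub is closed; the Yang–Mills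
mass gap is NOT proved.  References: T. Bałaban, CMP **99** (1985) [Balaban1985RegularSpaces]; CMP **96** (1984) [Balaban1984PropagatorsII] (the `ℓ²` bookkeeping of averaging kernels).
-/

set_option autoImplicit false

noncomputable section

open Finset
open scoped BigOperators

namespace Summit.QuantumFields.YangMills.Theorems.FluctuationComparisonRegPrIntLS2BetaSchurTest

variable {α β : Type*}

/-- One row of the Schur test: for `K_b ≥ 0`, `(Σ_b K_b·g_b)² ≤ (Σ_b K_b)·(Σ_b K_b·g_b²)` (Cauchy–Schwarz with the weights `√K_b`). [folklore] -/
theorem sq_sum_mul_le_sum_mul_sum_mul_sq (t : Finset β) (K g : β → ℝ) (hK : ∀ b ∈ t, 0 ≤ K b) :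
    (∑ b ∈ t, K b * g b) ^ 2 ≤ (∑ b ∈ t, K b) * ∑ b ∈ t, K b * g b ^ 2 := by
  have h := Finset.sum_mul_sq_le_sq_mul_sq t (fun b => Real.sqrt (K b)) (fun b => Real.sqrt (K b) * g b)
  have e1 : ∀ b ∈ t, Real.sqrt (K b) * (Real.sqrt (K b) * g b) = K b * g b := fun b hb => by
    rw [← mul_assoc, Real.mul_self_sqrt (hK b hb)]
  have e2 : ∀ b ∈ t, Real.sqrt (K b) ^ 2 = K b := fun b hb => Real.sq_sqrt (hK b hb)
  have e3 : ∀ b ∈ t, (Real.sqrt (K b) * g b) ^ 2 = K b * g b ^ 2 := fun b hb => by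
    rw [mul_pow, Real.sq_sqrt (hK b hb)]
  rw [Finset.sum_congr rfl e1, Finset.sum_congr rfl e2, Finset.sum_congr rfl e3] at h
  exact h

/-- ★★ **THE SCHUR TEST (squared form)**: a kernel `K ≥ 0` on `s × t` with row sums `Σ_{b∈t} K a b ≤ R` and column sums `Σ_{a∈s} K a b ≤ C` satisfies
`Σ_{a∈s} (Σ_{b∈t} K a b·g b)² ≤ R·C·Σ_{b∈t} (g b)²` for every `g` (`0 ≤ R` stated for the empty-`s` edge). [folklore] -/
theorem schur_test_sq (s : Finset α) (t : Finset β) (K : α → β → ℝ) (hK : ∀ a ∈ s, ∀ b ∈ t, 0 ≤ K a b) {R C : ℝ} (hR : 0 ≤ R)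
    (hrow : ∀ a ∈ s, ∑ b ∈ t, K a b ≤ R) (hcol : ∀ b ∈ t, ∑ a ∈ s, K a b ≤ C) (g : β → ℝ) :
    ∑ a ∈ s, (∑ b ∈ t, K a b * g b) ^ 2 ≤ R * C * ∑ b ∈ t, g b ^ 2 := by
  have hrowCS : ∀ a ∈ s, (∑ b ∈ t, K a b * g b) ^ 2 ≤ R * ∑ b ∈ t, K a b * g b ^ 2 := fun a ha =>
    (sq_sum_mul_le_sum_mul_sum_mul_sq t (K a) g (hK a ha)).trans
      (mul_le_mul_of_nonneg_right (hrow a ha) (Finset.sum_nonneg fun b hb => mul_nonneg (hK a ha b hb) (sq_nonneg _)))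
  calc ∑ a ∈ s, (∑ b ∈ t, K a b * g b) ^ 2 ≤ ∑ a ∈ s, R * ∑ b ∈ t, K a b * g b ^ 2 := Finset.sum_le_sum hrowCS
    _ = R * ∑ b ∈ t, (∑ a ∈ s, K a b) * g b ^ 2 := by
        rw [← Finset.mul_sum, Finset.sum_comm]
        congr 1
        exact Finset.sum_congr rfl fun b _ => by rw [Finset.sum_mul]
    _ ≤ R * ∑ b ∈ t, C * g b ^ 2 := by
        refine mul_le_mul_of_nonneg_left (Finset.sum_le_sum fun b hb => ?_) hR
        exact mul_le_mul_of_nonneg_right (hcol b hb) (sq_nonneg _)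
    _ = R * C * ∑ b ∈ t, g b ^ 2 := by rw [← Finset.mul_sum, mul_assoc]

/-- ★★ **THE SCHUR TEST (operator-norm form)**: `√(Σ_a (Σ_b K a b·g b)²) ≤ √(R·C)·√(Σ_b (g b)²)` — `‖T‖_{ℓ²→ℓ²} ≤ √(R·C)`; for the one-level tent kernel
(`R = L²`, `C = L⁻¹`) this is `‖T_t‖ ≤ √L` with constant one. [folklore] -/
theorem schur_test (s : Finset α) (t : Finset β) (K : α → β → ℝ) (hK : ∀ a ∈ s, ∀ b ∈ t, 0 ≤ K a b) {R C : ℝ} (hR : 0 ≤ R)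
    (hrow : ∀ a ∈ s, ∑ b ∈ t, K a b ≤ R) (hcol : ∀ b ∈ t, ∑ a ∈ s, K a b ≤ C) (g : β → ℝ) :
    Real.sqrt (∑ a ∈ s, (∑ b ∈ t, K a b * g b) ^ 2) ≤ Real.sqrt (R * C) * Real.sqrt (∑ b ∈ t, g b ^ 2) := by
  rw [← Real.sqrt_mul' _ (Finset.sum_nonneg fun b _ => sq_nonneg _)]
  exact Real.sqrt_le_sqrt (schur_test_sq s t K hK hR hrow hcol g)

/-- The tower: operator bounds multiply — if `‖T g‖ ≤ q·‖g‖` levelwise (`F (i+1) ≤ q i · F i`, `0 ≤ q`), then `F t ≤ (Π_{i<t} q i)·F 0`. [folklore] -/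
theorem le_prod_mul_of_forall_le_mul (F q : ℕ → ℝ) (hq : ∀ i, 0 ≤ q i) (h : ∀ i, F (i + 1) ≤ q i * F i) (t : ℕ) :
    F t ≤ (∏ i ∈ range t, q i) * F 0 := by
  induction t with
  | zero => simp
  | succ t ih =>
    calc F (t + 1) ≤ q t * F t := h t
      _ ≤ q t * ((∏ i ∈ range t, q i) * F 0) := mul_le_mul_of_nonneg_left ih (hq t)
      _ = (∏ i ∈ range (t + 1), q i) * F 0 := by rw [Finset.prod_range_succ]; ring

/-- With `q i = √L·(1 + δ i)`, `0 ≤ δ`: `Π_{i<t} q i ≤ (√L)^t · exp(Σ_{i<t} δ i)` — the KEY LEMMA's depth-free constant. [folklore] -/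
theorem prod_sqrt_mul_one_add_le (L : ℝ) (δ : ℕ → ℝ) (hδ : ∀ i, 0 ≤ δ i) (t : ℕ) :
    ∏ i ∈ range t, Real.sqrt L * (1 + δ i) ≤ Real.sqrt L ^ t * Real.exp (∑ i ∈ range t, δ i) := by
  rw [Finset.prod_mul_distrib, Finset.prod_const, Finset.card_range, Real.exp_sum]
  refine mul_le_mul_of_nonneg_left ?_ (pow_nonneg (Real.sqrt_nonneg _) _)
  exact Finset.prod_le_prod (fun i _ => by linarith [hδ i]) fun i _ => by linarith [Real.add_one_le_exp (δ i)]

end Summit.QuantumFields.YangMills.Theorems.FluctuationComparisonRegPrIntLS2BetaSchurTest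

end
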